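import Literature.MathematicalPhysics.QuantumLattice.GibbsKMSMomentCuts
import HarnessLib

/-!
# KMS moment cuts, II: the scalar moment rows, the `K = 1` (energy–entropy-balance) case, and the
# canonical SECTOR eigen-mixture

Topic `Literature/MathematicalPhysics/QuantumLattice`; continuation of `GibbsKMSMomentCuts.lean`, whose
`sum_exp_mul_re_expect_momentCut_nonneg` proves: for a Hermitian `H` with eigenbasis `v_c`, eigenvalues
`E_c`, generators `a_i`, real `β` and coefficient matrices `P_k, Q_k` (`k ≤ K`) with
`Π(u) = Σ_k u^k P_k + e^{−u} Σ_k u^k Q_k ⪰ 0` for every real `u`, the KMS moment cut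
`R = Σ_k Σ_{ij} β^k [(P_k)_{ij} · a_iᴴ ad_H^k(a_j) + (Q_k)_{ij} · ad_H^k(a_j) a_iᴴ]` has
`0 ≤ Σ_c e^{−βE_c} Re⟨v_c, R v_c⟩`.

* §3 `sum_exp_mul_re_expect_momentRow_nonneg` — the SCALAR rows (`m = 1`): for real `p_k, q_k` with
  `0 ≤ Σ_k p_k u^k + e^{−u} Σ_k q_k u^k` on all of `ℝ`,
  `0 ≤ Σ_c e^{−βE_c} Re⟨v_c, Σ_k β^k (p_k · aᴴ ad_H^k(a) + q_k · ad_H^k(a) aᴴ) v_c⟩` (the «KMS moment rows»: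
  tangent/linearised-EEB rows for `K = 1`; Itoi–Ishimori–Sato–Sakamoto Thm. 3 (`n = 0`),
  `⟨[A†,[H,A]]⟩ ≤ (β/2)⟨{[H,A]†,[H,A]}⟩`, for `K = 2`, `p = (0, −1, ½)`, `q = (0, 1, ½)`); the bookkeeping
  `momentCut_unit_eq`, `posSemidef_momentCut_unit_of_nonneg`; and `momentCut_oneParam_of_matrixCut`: with
  `P = (Λ_A, Λ_C)`, `Q = (Λ_B, 0)` the one-parameter family is `Λ_A + e^{−u}Λ_B + uΛ_C`, i.e. the matrix
  energy–entropy-balance cuts of `GibbsEnergyEntropyBalanceMatrixCuts.lean` are the `K = 1` moment cuts.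
* §4 `sum_canonicalWeight_mul_re_expect_momentCut_nonneg` — the canonical SECTOR eigen-mixture
  (`canonicalWeight`, `sectorEigenvector` of `TorusSectorGibbsMixture.lean`; `A` Hermitian with no entries
  between the coordinate sector `p` and its complement) for generators `a_i` such that `a_i` and `a_iᴴ`
  preserve the sector (gauge-invariant generators; the canonical state is not KMS for sector-changing
  ones): compress to the sector (`iterate_commutator_apply_eq_zero_off_and_submatrix`:
  `ad_A^k(X)|_p = ad_{A|_p}^k(X|_p)`) and apply the full-space theorem; plus the scalar sector rows
  `sum_canonicalWeight_mul_re_expect_momentRow_nonneg`.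

Everything is PROVED; no definition, no named fact.

## Mathlib / tree search

REUSED: tree `sum_exp_mul_re_expect_momentCut_nonneg` (`GibbsKMSMomentCuts`), `mul_apply_eq_zero_off`
(`GibbsEnergyEntropyBalance`), `sectorExtend/sectorEigenvector/canonicalWeight` (`TorusSectorGibbsMixture`);
Mathlib `Matrix.PosSemidef.one`, `.smul`, `Fintype.sum_unique`, `Fin.sum_univ_two`, `Matrix.submatrix_*`.

## References

* C. Itoi, H. Ishimori, K. Sato, Y. Sakamoto, J. Phys. Soc. Jpn. 92 (2023) 074001 = arXiv:2306.03489, §2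
  Thm. 3, §3 Lemma 5. [cite: ItoiEtAl2023, Theorem 3]
* H. Fawzi, O. Fawzi, S. O. Scalet, Nat. Commun. 15 (2024) 7394 = arXiv:2311.18706, §3.1 Thm. 3.1, §3.2
  Thm. 3.4. [cite: FawziFawziScalet2024, Thm. 3.4]
* H. Tasaki, *Physics and Mathematics of Quantum Many-Body Systems* (2020), §2.2 (symmetry sectors).
  [cite: Tasaki2020, §2.2]
-/

noncomputable section

namespace Literature.MathematicalPhysics.QuantumLattice

open Matrix Finset
open scoped ComplexOrder BigOperators

/-! ### §3 The scalar KMS moment rows (`m = 1`) and the `K = 1` (energy–entropy-balance) case -/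

section Scalar

variable {κ : Type*} [Fintype κ] [DecidableEq κ]

omit [DecidableEq κ] in
/-- The `1 × 1` moment cut with coefficient «matrices» `p_k • 1`, `q_k • 1` is the scalar moment row
`Σ_k β^k (p_k · aᴴ ad_H^k(a) + q_k · ad_H^k(a) aᴴ)` (the word combination of the scalar KMS moment rows /
series correlation inequalities). [cite: ItoiEtAl2023, Theorem 3] -/
theorem momentCut_unit_eq (H a : Matrix κ κ ℂ) (β : ℝ) {K : ℕ} (p q : Fin (K + 1) → ℝ) :
    (∑ k : Fin (K + 1), ∑ i : Unit, ∑ j : Unit,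
        ((((β ^ (k : ℕ) : ℝ) : ℂ) * (((p k : ℝ) : ℂ) • (1 : Matrix Unit Unit ℂ)) i j) •
            (aᴴ * (fun X : Matrix κ κ ℂ => H * X - X * H)^[(k : ℕ)] a) +
          (((β ^ (k : ℕ) : ℝ) : ℂ) * (((q k : ℝ) : ℂ) • (1 : Matrix Unit Unit ℂ)) i j) •
            ((fun X : Matrix κ κ ℂ => H * X - X * H)^[(k : ℕ)] a * aᴴ))) =
      ∑ k : Fin (K + 1), ((((β ^ (k : ℕ) * p k : ℝ) : ℂ)) • (aᴴ * (fun X : Matrix κ κ ℂ => H * X - X * H)^[(k : ℕ)] a) +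
        (((β ^ (k : ℕ) * q k : ℝ) : ℂ)) • ((fun X : Matrix κ κ ℂ => H * X - X * H)^[(k : ℕ)] a * aᴴ)) := by
  refine Finset.sum_congr rfl fun k _ => ?_
  rw [Fintype.sum_unique, Fintype.sum_unique]
  simp only [Matrix.smul_apply, Matrix.one_apply_eq, smul_eq_mul, mul_one, Complex.ofReal_mul,
    Complex.ofReal_pow]

/-- The `1 × 1` one-parameter condition: `(Σ_k u^k p_k + e^{−u} Σ_k u^k q_k) • 1 ⪰ 0` as soon as the scalar
exponential polynomial `p(u) + e^{−u} q(u)` is `≥ 0` (the scalar positivity condition of the series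
correlation inequalities, e.g. Itoi et al. Lemma 6). [cite: ItoiEtAl2023, Lemma 6] -/
theorem posSemidef_momentCut_unit_of_nonneg {K : ℕ} {p q : Fin (K + 1) → ℝ} {u : ℝ}
    (hpq : 0 ≤ ∑ k, p k * u ^ (k : ℕ) + Real.exp (-u) * ∑ k, q k * u ^ (k : ℕ)) :
    (∑ k : Fin (K + 1), ((u ^ (k : ℕ) : ℝ) : ℂ) • (((p k : ℝ) : ℂ) • (1 : Matrix Unit Unit ℂ)) +
      ((Real.exp (-u) : ℝ) : ℂ) •
        ∑ k : Fin (K + 1), ((u ^ (k : ℕ) : ℝ) : ℂ) • (((q k : ℝ) : ℂ) • (1 : Matrix Unit Unit ℂ))).PosSemidef := by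
  have h : (∑ k : Fin (K + 1), ((u ^ (k : ℕ) : ℝ) : ℂ) • (((p k : ℝ) : ℂ) • (1 : Matrix Unit Unit ℂ)) +
      ((Real.exp (-u) : ℝ) : ℂ) •
        ∑ k : Fin (K + 1), ((u ^ (k : ℕ) : ℝ) : ℂ) • (((q k : ℝ) : ℂ) • (1 : Matrix Unit Unit ℂ))) =
      (((∑ k, p k * u ^ (k : ℕ) + Real.exp (-u) * ∑ k, q k * u ^ (k : ℕ) : ℝ) : ℂ)) • (1 : Matrix Unit Unit ℂ) := by
    simp only [smul_smul, ← Finset.sum_smul]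
    rw [← add_smul]
    congr 1
    push_cast
    congr 1
    · exact Finset.sum_congr rfl fun k _ => mul_comm _ _
    · congr 1
      exact Finset.sum_congr rfl fun k _ => mul_comm _ _
  rw [h]
  exact Matrix.PosSemidef.one.smul (Complex.zero_le_real.2 hpq)

/-- **Scalar KMS moment rows for the canonical eigen-mixture of a Hermitian matrix.** Let `H` be
Hermitian with eigenbasis `v_c`, eigenvalues `E_c`, `a` any matrix, `β` real, and real coefficients
`p_0 … p_K`, `q_0 … q_K` whose exponential polynomial is nonnegative on the whole line:
`0 ≤ Σ_k p_k u^k + e^{−u} Σ_k q_k u^k` for every real `u`. Then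
`0 ≤ Σ_c e^{−βE_c} Re⟨v_c, Σ_k β^k (p_k · aᴴ ad_H^k(a) + q_k · ad_H^k(a) aᴴ) v_c⟩` —
the rows `Σ_k β^k p_k ω(a† ad_H^k a) + Σ_k β^k q_k ω(ad_H^k(a) a†) ≥ 0` of the Gibbs state (note
`ad_H^k(a) a† = (−1)^k (a ad_H^k(a†))†`, so the second family is `(−1)^k ω(a ad_H^k a†)` up to complex
conjugation). `K = 1`, `p = (−s, 1)`, `q = (e^{s−1}, 0)` is the tangent (linearised EEB) row; Itoi et al.
Thm. 3 (`n = 0`) is `K = 2`, `p = (0, −1, ½)`, `q = (0, 1, ½)`. [cite: ItoiEtAl2023, Theorem 3]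
[cite: FawziFawziScalet2024, Thm. 3.1] -/
theorem sum_exp_mul_re_expect_momentRow_nonneg {H : Matrix κ κ ℂ} (hH : H.IsHermitian)
    (a : Matrix κ κ ℂ) (β : ℝ) {K : ℕ} {p q : Fin (K + 1) → ℝ}
    (hpq : ∀ u : ℝ, 0 ≤ ∑ k, p k * u ^ (k : ℕ) + Real.exp (-u) * ∑ k, q k * u ^ (k : ℕ)) :
    0 ≤ ∑ c, Real.exp (-(β * hH.eigenvalues c)) *
      (star (fun i => (hH.eigenvectorUnitary : Matrix κ κ ℂ) i c) ⬝ᵥ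
        ((∑ k : Fin (K + 1),
            ((((β ^ (k : ℕ) * p k : ℝ) : ℂ)) • (aᴴ * (fun X : Matrix κ κ ℂ => H * X - X * H)^[(k : ℕ)] a) +
              (((β ^ (k : ℕ) * q k : ℝ) : ℂ)) • ((fun X : Matrix κ κ ℂ => H * X - X * H)^[(k : ℕ)] a * aᴴ))) *ᵥ
          fun i => (hH.eigenvectorUnitary : Matrix κ κ ℂ) i c)).re := by
  have h := sum_exp_mul_re_expect_momentCut_nonneg hH (fun _ : Unit => a) β
    (P := fun k => ((p k : ℝ) : ℂ) • (1 : Matrix Unit Unit ℂ))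
    (Q := fun k => ((q k : ℝ) : ℂ) • (1 : Matrix Unit Unit ℂ)) fun u => posSemidef_momentCut_unit_of_nonneg (hpq u)
  rwa [momentCut_unit_eq] at h

/-- **The matrix energy–entropy-balance cuts are the `K = 1` moment cuts**: with `P = (Λ_A, Λ_C)` and
`Q = (Λ_B, 0)` the one-parameter family of this file is `Λ_A + e^{−u} Λ_B + u Λ_C`, the condition of
`sum_exp_mul_re_expect_matrixCut_nonneg`. [cite: FawziFawziScalet2024, Thm. 3.4] -/
theorem momentCut_oneParam_of_matrixCut {m : Type*} (ΛA ΛB ΛC : Matrix m m ℂ) (u : ℝ) :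
    ∑ k : Fin 2, ((u ^ (k : ℕ) : ℝ) : ℂ) • (![ΛA, ΛC] : Fin 2 → Matrix m m ℂ) k +
        ((Real.exp (-u) : ℝ) : ℂ) • ∑ k : Fin 2, ((u ^ (k : ℕ) : ℝ) : ℂ) • (![ΛB, 0] : Fin 2 → Matrix m m ℂ) k =
      ΛA + ((Real.exp (-u) : ℝ) : ℂ) • ΛB + ((u : ℝ) : ℂ) • ΛC := by
  simp only [Fin.sum_univ_two, Fin.isValue, Fin.val_zero, Fin.val_one, pow_zero, pow_one,
    Matrix.cons_val_zero, Matrix.cons_val_one, Complex.ofReal_one, one_smul, smul_zero, add_zero]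
  abel

end Scalar

/-! ### §4 KMS moment cuts for the canonical eigen-mixture compressed to an invariant coordinate sector -/

section CoordinateSector

variable {ι : Type*} [Fintype ι] [DecidableEq ι] (p : ι → Prop) [DecidablePred p]
variable {m : Type*} [Fintype m]

omit [DecidableEq ι] in
/-- A sum over all coordinates of a function vanishing off the sector is the sum over the sector.
[folklore] -/
private theorem sum_eq_sum_subtype_of_eq_zero_off₄ (f : ι → ℂ) (hf : ∀ i, ¬ p i → f i = 0) :
    ∑ i, f i = ∑ a : Subtype p, f a.1 := by
  rw [← Finset.sum_subtype (Finset.univ.filter p) (by simp), Finset.sum_filter_of_ne]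
  intro i _ hi
  by_contra h
  exact hi (hf i h)

omit [DecidableEq ι] in
/-- `⟨ext φ, X ext φ⟩ = ⟨φ, X|_p φ⟩` for every matrix `X`. [folklore] -/
private theorem star_sectorExtend_dotProduct_mulVec_sectorExtend₄ (X : Matrix ι ι ℂ) (φ : Subtype p → ℂ) :
    star (sectorExtend p φ) ⬝ᵥ (X *ᵥ sectorExtend p φ) =
      star φ ⬝ᵥ (X.submatrix (Subtype.val : Subtype p → ι) Subtype.val *ᵥ φ) := by
  have hext : ∀ a : Subtype p, sectorExtend p φ a.1 = φ a := fun a => by simp [sectorExtend, a.2]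
  have hoff : ∀ i, ¬ p i → sectorExtend p φ i = 0 := fun i hi => by simp [sectorExtend, hi]
  rw [dotProduct, dotProduct, sum_eq_sum_subtype_of_eq_zero_off₄ p]
  · refine Finset.sum_congr rfl fun a _ => ?_
    rw [Pi.star_apply, Pi.star_apply, hext, mulVec, mulVec, dotProduct, dotProduct,
      sum_eq_sum_subtype_of_eq_zero_off₄ p]
    · simp only [Matrix.submatrix_apply, hext]
    · intro j hj
      rw [hoff j hj, mul_zero]
  · intro i hi
    rw [Pi.star_apply, hoff i hi, star_zero, zero_mul]

omit [DecidableEq ι] in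
/-- Right factor maps the sector into itself ⇒ `(M N)|_p = M|_p N|_p`. [folklore] -/
private theorem submatrix_mul_of_right₄ (M N : Matrix ι ι ℂ) (hN : ∀ i j, ¬ p i → p j → N i j = 0) :
    (M * N).submatrix (Subtype.val : Subtype p → ι) (Subtype.val : Subtype p → ι) =
      M.submatrix (Subtype.val : Subtype p → ι) (Subtype.val : Subtype p → ι) *
        N.submatrix (Subtype.val : Subtype p → ι) (Subtype.val : Subtype p → ι) := by
  ext a b
  rw [Matrix.submatrix_apply, Matrix.mul_apply, Matrix.mul_apply, sum_eq_sum_subtype_of_eq_zero_off₄ p]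
  · rfl
  · intro k hk
    rw [hN k b.1 hk b.2, mul_zero]

omit [Fintype ι] [DecidableEq ι] [DecidablePred p] [Fintype m] in
/-- Compression commutes with finite sums of matrices. [folklore] -/
private theorem submatrix_sum₄ {n : Type*} (s : Finset n) (M : n → Matrix ι ι ℂ) :
    (∑ i ∈ s, M i).submatrix (Subtype.val : Subtype p → ι) (Subtype.val : Subtype p → ι) =
      ∑ i ∈ s, (M i).submatrix (Subtype.val : Subtype p → ι) (Subtype.val : Subtype p → ι) := by
  ext a b
  simp only [Matrix.submatrix_apply, Matrix.sum_apply]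

omit [DecidableEq ι] in
/-- **Iterated commutators of sector-preserving matrices are sector preserving and compress termwise**:
if `A` and `X` have no entries from the sector into its complement, then so does `ad_A^k(X)`, and
`ad_A^k(X)|_p = ad_{A|_p}^k(X|_p)`. [cite: Tasaki2020, §2.2] -/
theorem iterate_commutator_apply_eq_zero_off_and_submatrix {A X : Matrix ι ι ℂ}
    (hA : ∀ i j, ¬ p i → p j → A i j = 0) (hX : ∀ i j, ¬ p i → p j → X i j = 0) (k : ℕ) :
    (∀ i j, ¬ p i → p j → ((fun Y : Matrix ι ι ℂ => A * Y - Y * A)^[k] X) i j = 0) ∧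
      ((fun Y : Matrix ι ι ℂ => A * Y - Y * A)^[k] X).submatrix (Subtype.val : Subtype p → ι) Subtype.val =
        (fun Y : Matrix (Subtype p) (Subtype p) ℂ =>
            A.submatrix (Subtype.val : Subtype p → ι) Subtype.val * Y -
              Y * A.submatrix (Subtype.val : Subtype p → ι) Subtype.val)^[k]
          (X.submatrix (Subtype.val : Subtype p → ι) Subtype.val) := by
  induction k with
  | zero => exact ⟨hX, rfl⟩
  | succ k ih =>
    obtain ⟨ih0, ih1⟩ := ih
    refine ⟨fun i j hi hj => ?_, ?_⟩
    · rw [Function.iterate_succ_apply', Matrix.sub_apply, mul_apply_eq_zero_off p hA ih0 i j hi hj,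
        mul_apply_eq_zero_off p ih0 hA i j hi hj, sub_zero]
    · rw [Function.iterate_succ_apply', Function.iterate_succ_apply', ← ih1, Matrix.submatrix_sub,
        Pi.sub_apply, Pi.sub_apply, submatrix_mul_of_right₄ p A _ ih0, submatrix_mul_of_right₄ p _ A hA]

/-- **KMS moment cuts for the canonical sector Gibbs eigen-mixture.** Let `A` be Hermitian with no
entries between the coordinate sector `p` and its complement, `(w_c, ψ_c)` its canonical sector
eigen-mixture at inverse temperature `β` (`canonicalWeight`, `sectorEigenvector`), `a : m → Matrix`
generators such that every `a_i` and every `a_iᴴ` maps the sector into itself, and `P, Q : Fin (K+1) → Matrix m m ℂ`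
with `Σ_k u^k P_k + e^{−u} Σ_k u^k Q_k ⪰ 0` for all real `u`. Then `0 ≤ Σ_c w_c Re⟨ψ_c, R ψ_c⟩` for the moment cut
`R = Σ_k Σ_{ij} [β^k (P_k)_{ij} · a_iᴴ ad_A^k(a_j) + β^k (Q_k)_{ij} · ad_A^k(a_j) a_iᴴ]` — the KMS moment rows
of the canonical Gibbs state `tr(P_p e^{−βA} ·)/Z_p` for sector-preserving generators (compress to the
sector, `iterate_commutator_apply_eq_zero_off_and_submatrix`, and apply `sum_exp_mul_re_expect_momentCut_nonneg`).
[cite: ItoiEtAl2023, Lemma 5] [cite: FawziFawziScalet2024, Thm. 3.4] -/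
theorem sum_canonicalWeight_mul_re_expect_momentCut_nonneg {A : Matrix ι ι ℂ} (hA : A.IsHermitian)
    (hinv : ∀ i j, ¬ p i → p j → A i j = 0) {a : m → Matrix ι ι ℂ}
    (ha : ∀ l i j, ¬ p i → p j → a l i j = 0) (ha' : ∀ l i j, ¬ p i → p j → (a l)ᴴ i j = 0)
    (β : ℝ) {K : ℕ} {P Q : Fin (K + 1) → Matrix m m ℂ}
    (hPi : ∀ u : ℝ, (∑ k : Fin (K + 1), ((u ^ (k : ℕ) : ℝ) : ℂ) • P k +
        ((Real.exp (-u) : ℝ) : ℂ) • ∑ k : Fin (K + 1), ((u ^ (k : ℕ) : ℝ) : ℂ) • Q k).PosSemidef) :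
    0 ≤ ∑ c, canonicalWeight β (sectorEigenvalue p A hA) c *
      (star (sectorEigenvector p A hA c) ⬝ᵥ
        ((∑ k : Fin (K + 1), ∑ i, ∑ j,
            ((((β ^ (k : ℕ) : ℝ) : ℂ) * P k i j) •
                ((a i)ᴴ * (fun X : Matrix ι ι ℂ => A * X - X * A)^[(k : ℕ)] (a j)) +
              (((β ^ (k : ℕ) : ℝ) : ℂ) * Q k i j) •
                ((fun X : Matrix ι ι ℂ => A * X - X * A)^[(k : ℕ)] (a j) * (a i)ᴴ))) *ᵥ
          sectorEigenvector p A hA c)).re := by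
  set hAp := hA.submatrix (Subtype.val : Subtype p → ι) with hApdef
  set Ap : Matrix (Subtype p) (Subtype p) ℂ := A.submatrix (Subtype.val : Subtype p → ι) Subtype.val with hAp'
  set ap : m → Matrix (Subtype p) (Subtype p) ℂ :=
    fun l => (a l).submatrix (Subtype.val : Subtype p → ι) Subtype.val with hap
  have hapk : ∀ l, (a l).submatrix (Subtype.val : Subtype p → ι) Subtype.val = ap l := fun l => rfl
  have hat : ∀ l, ((a l)ᴴ).submatrix (Subtype.val : Subtype p → ι) Subtype.val = (ap l)ᴴ := fun l => by
    rw [← hapk, Matrix.conjTranspose_submatrix]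
  -- compression of the iterated commutators
  have had0 : ∀ (l : m) (k : ℕ) (i j : ι), ¬ p i → p j →
      ((fun X : Matrix ι ι ℂ => A * X - X * A)^[k] (a l)) i j = 0 := fun l k =>
    (iterate_commutator_apply_eq_zero_off_and_submatrix p hinv (ha l) k).1
  have had1 : ∀ (l : m) (k : ℕ),
      ((fun X : Matrix ι ι ℂ => A * X - X * A)^[k] (a l)).submatrix (Subtype.val : Subtype p → ι) Subtype.val =
        (fun Y : Matrix (Subtype p) (Subtype p) ℂ => Ap * Y - Y * Ap)^[k] (ap l) := fun l k =>
    (iterate_commutator_apply_eq_zero_off_and_submatrix p hinv (ha l) k).2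
  -- compression of the cut
  have hsub : (∑ k : Fin (K + 1), ∑ i, ∑ j,
        ((((β ^ (k : ℕ) : ℝ) : ℂ) * P k i j) •
            ((a i)ᴴ * (fun X : Matrix ι ι ℂ => A * X - X * A)^[(k : ℕ)] (a j)) +
          (((β ^ (k : ℕ) : ℝ) : ℂ) * Q k i j) •
            ((fun X : Matrix ι ι ℂ => A * X - X * A)^[(k : ℕ)] (a j) * (a i)ᴴ))).submatrix
          (Subtype.val : Subtype p → ι) Subtype.val =
      ∑ k : Fin (K + 1), ∑ i, ∑ j,
        ((((β ^ (k : ℕ) : ℝ) : ℂ) * P k i j) •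
            ((ap i)ᴴ * (fun Y : Matrix (Subtype p) (Subtype p) ℂ => Ap * Y - Y * Ap)^[(k : ℕ)] (ap j)) +
          (((β ^ (k : ℕ) : ℝ) : ℂ) * Q k i j) •
            ((fun Y : Matrix (Subtype p) (Subtype p) ℂ => Ap * Y - Y * Ap)^[(k : ℕ)] (ap j) * (ap i)ᴴ)) := by
    rw [submatrix_sum₄]
    refine Finset.sum_congr rfl fun k _ => ?_
    rw [submatrix_sum₄]
    refine Finset.sum_congr rfl fun i _ => ?_
    rw [submatrix_sum₄]
    refine Finset.sum_congr rfl fun j _ => ?_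
    simp only [Matrix.submatrix_add, Matrix.submatrix_smul, Pi.add_apply, Pi.smul_apply,
      submatrix_mul_of_right₄ p (a i)ᴴ _ (had0 j (k : ℕ)), submatrix_mul_of_right₄ p _ (a i)ᴴ (ha' i),
      had1, hat]
  have hterm : ∀ c : Subtype p,
      star (sectorEigenvector p A hA c) ⬝ᵥ
        ((∑ k : Fin (K + 1), ∑ i, ∑ j,
            ((((β ^ (k : ℕ) : ℝ) : ℂ) * P k i j) •
                ((a i)ᴴ * (fun X : Matrix ι ι ℂ => A * X - X * A)^[(k : ℕ)] (a j)) +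
              (((β ^ (k : ℕ) : ℝ) : ℂ) * Q k i j) •
                ((fun X : Matrix ι ι ℂ => A * X - X * A)^[(k : ℕ)] (a j) * (a i)ᴴ))) *ᵥ sectorEigenvector p A hA c) =
      star (fun b => (hAp.eigenvectorUnitary : Matrix (Subtype p) (Subtype p) ℂ) b c) ⬝ᵥ
        ((∑ k : Fin (K + 1), ∑ i, ∑ j,
            ((((β ^ (k : ℕ) : ℝ) : ℂ) * P k i j) •
                ((ap i)ᴴ * (fun Y : Matrix (Subtype p) (Subtype p) ℂ => Ap * Y - Y * Ap)^[(k : ℕ)] (ap j)) +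
              (((β ^ (k : ℕ) : ℝ) : ℂ) * Q k i j) •
                ((fun Y : Matrix (Subtype p) (Subtype p) ℂ => Ap * Y - Y * Ap)^[(k : ℕ)] (ap j) * (ap i)ᴴ))) *ᵥ
          fun b => (hAp.eigenvectorUnitary : Matrix (Subtype p) (Subtype p) ℂ) b c) := by
    intro c
    rw [sectorEigenvector, star_sectorExtend_dotProduct_mulVec_sectorExtend₄, hsub]
  have hw : ∀ c : Subtype p, canonicalWeight β (sectorEigenvalue p A hA) c =
      (∑ b, Real.exp (-(β * hAp.eigenvalues b)))⁻¹ * Real.exp (-(β * hAp.eigenvalues c)) := fun c => rfl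
  simp_rw [hterm, hw, mul_assoc, ← Finset.mul_sum]
  exact mul_nonneg (inv_nonneg.2 (Finset.sum_nonneg fun _ _ => (Real.exp_pos _).le))
    (sum_exp_mul_re_expect_momentCut_nonneg hAp ap β hPi)

/-- **Scalar KMS moment rows for the canonical sector Gibbs eigen-mixture**: for a sector-preserving
generator `a` (with `aᴴ` sector preserving) and real `p_k, q_k` with `0 ≤ Σ_k p_k u^k + e^{−u} Σ_k q_k u^k`
on `ℝ`: `0 ≤ Σ_c w_c Re⟨ψ_c, Σ_k β^k (p_k · aᴴ ad_A^k(a) + q_k · ad_A^k(a) aᴴ) ψ_c⟩`.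
[cite: ItoiEtAl2023, Theorem 3] [cite: FawziFawziScalet2024, Thm. 3.1] -/
theorem sum_canonicalWeight_mul_re_expect_momentRow_nonneg {A : Matrix ι ι ℂ} (hA : A.IsHermitian)
    (hinv : ∀ i j, ¬ p i → p j → A i j = 0) {a : Matrix ι ι ℂ}
    (ha : ∀ i j, ¬ p i → p j → a i j = 0) (ha' : ∀ i j, ¬ p i → p j → aᴴ i j = 0)
    (β : ℝ) {K : ℕ} {p' q' : Fin (K + 1) → ℝ}
    (hpq : ∀ u : ℝ, 0 ≤ ∑ k, p' k * u ^ (k : ℕ) + Real.exp (-u) * ∑ k, q' k * u ^ (k : ℕ)) :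
    0 ≤ ∑ c, canonicalWeight β (sectorEigenvalue p A hA) c *
      (star (sectorEigenvector p A hA c) ⬝ᵥ
        ((∑ k : Fin (K + 1),
            ((((β ^ (k : ℕ) * p' k : ℝ) : ℂ)) • (aᴴ * (fun X : Matrix ι ι ℂ => A * X - X * A)^[(k : ℕ)] a) +
              (((β ^ (k : ℕ) * q' k : ℝ) : ℂ)) • ((fun X : Matrix ι ι ℂ => A * X - X * A)^[(k : ℕ)] a * aᴴ))) *ᵥ
          sectorEigenvector p A hA c)).re := by
  have h := sum_canonicalWeight_mul_re_expect_momentCut_nonneg p hA hinv (a := fun _ : Unit => a)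
    (fun _ => ha) (fun _ => ha') β
    (P := fun k => ((p' k : ℝ) : ℂ) • (1 : Matrix Unit Unit ℂ))
    (Q := fun k => ((q' k : ℝ) : ℂ) • (1 : Matrix Unit Unit ℂ)) fun u => posSemidef_momentCut_unit_of_nonneg (hpq u)
  rwa [momentCut_unit_eq] at h

end CoordinateSector


end Literature.MathematicalPhysics.QuantumLattice

end
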